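import Summits.KontsevichZagierPeriods.KontsevichZagierPeriods.Theorems.SymplecticScissorsRealOnePeriodRelationsConditional
import Summits.KontsevichZagierPeriods.KontsevichZagierPeriods.Theorems.SymplecticScissorsRealOnePeriodRelationsUnifiedLayer

/-!
# Crux `RealOnePeriodRelations` (stmt-KontsevichZagierPeriods-10042) — line `nash-retraction-thin-strip`,
# continuation c8 (gen-1 lead): skeleton after RESHAPES 10–11 + the unified layer — everything but the apex is LANDED

Continuation c8 (lead `prover-line-stmt-KontsevichZagierPeriods-10042-c8-0`, 2026-08-17).  State of the line: the composition
`realOnePeriodRelations_of_huberWustholzCurvePeriods : HuberWustholzCurvePeriods → RealOnePeriodRelations` is landed (p131099) and so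
are the unconditional LAYERS of the crux, all with axioms `propext`, `Classical.choice`, `Quot.sound`:
Rat, Ell, Iso + SectorGlue, Loop (+ Legendre, cubic models), LogLoop, MultiEll (family general-point engine), Quartic, QuarticTail,
Bielliptic, AlgRat, Conic (c1–c7), and

* RESHAPE 10 (c8): **`TorsionLayer.realOnePeriodRelations_torsionLayer`** — the TORSION (THIRD-KIND) LAYER: every `ℤ`-relation with
  value `0` among rational representations, first/second-kind elliptic cells and tails on a real non-CM Weierstrass curve `E_{A,B}`, and
  TORSION CELLS `∫_a^b P(x) dx/(∏ᵢ (x − cᵢ)^{mᵢ} √(x³ + Ax + B))` with real torsion abscissae `cᵢ ∉ [a, b]` — incomplete elliptic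
  integrals of the THIRD kind with torsion singular divisor — lies in `M₁`, UNCONDITIONALLY; from the new apex sector
  **`TorsionLayer.huberWustholzCurvePeriods_torsionPunctured`** (Huber–Wüstholz 13.3 (2) for the torsion-punctured affine
  Weierstrass curves `C_T` with `E_L`, the punctured lines, `𝔾ₘ`, `𝔸¹`: arbitrary paths, ALL forms on `C_T`), proved by transfer
  (stubs `stub_formReductionP` — de Rham reduction on `C_T` —, `stub_torsPolyExists` + `stub_ellipticLiouville` + `stub_torsUnit` —
  the torsion units `G_±` of divisor `N(±P) − N(O)` without divisor theory —, `stub_transferTors`, `stub_torsArcs`; files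
  `Theorems/SymplecticScissorsRealOnePeriodRelations{TorsionCurve,TorsionCurveSmooth,StubTorsPolyExists,StubEllipticLiouville,
  StubFormReductionP(Aux),StubTorsUnitSigma,StubTorsUnitCore,StubTorsUnitAssembly,StubTorsUnit,StubTransferTorsA,StubTransferTorsB,
  StubTransferTors,StubTorsArcs,TorsionLayer}.lean`).

* RESHAPE 10 on FAMILIES (c8): **`TorsionLayer.realOnePeriodRelations_torsionLayer_family`** and the family apex sector
  **`TorsionLayer.huberWustholzCurvePeriods_torsionPunctured_family`** (torsion-punctured curves of a whole isogeny web
  `L_j ~ M_{κ j}`, `M_i` pairwise non-isogenous non-CM; file `…TorsionLayerFamily.lean`).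
* RESHAPE 11 (c8, cycle 9): **`TorsionLayer.realOnePeriodRelations_torsionLayerC_family`** — `(P, D)`-torsion cells with
  COMPLEX-CONJUGATE torsion poles (`D ∈ (ℚ̄ ∩ ℝ)[x]`, all complex roots torsion abscissae, `D ≠ 0` on `[a, b]`) and torsion TAILS
  `∫_M^∞ P dx/(D √f)` (`deg P ≤ deg D`; reduced to cells by the `2`-torsion translation, rule 2) on families (stubs `stub_torsArcsC`,
  `stub_torsTailC`; files `…StubTorsArcsC.lean`, `…StubTorsTailC.lean`, `…TorsionLayerC.lean`).  With it the THIRD-KIND elliptic sector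
  of the crux is complete relative to the tree's transcendence engine.

* UNIFIED LAYER (c8, cycle 10): **`TorsionLayer.realOnePeriodRelations_unifiedLayer_family`** — genus 0 (rational, algebraic-rational,
  conic cells) AND the whole non-CM elliptic sector (first/second-kind cells and tails, third-kind `(P, D)`-torsion cells and tails on an
  isogeny web) in ONE relation module: MIXED relations with value `0` lie in `M₁` (file `…UnifiedLayer.lean`; cells by the Euler
  substitutions + `stub_algRatCells` + `isoCells` + `stub_torsTailC`, arcs of reshape 11, sector of reshape 10).

The ONE open registered stub is the apex `stub_huberWustholz : HuberWustholzCurvePeriods` (Huber–Wüstholz 2022, Thm 13.3 (2) for ALL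
smooth affine curves over `ℚ̄`: open paths on CM curves, third-kind integrands with NON-torsion residue divisor, genus ≥ 2 beyond split
Jacobians — each needs the analytic subgroup theorem beyond the family standard models `𝔾ₘ^β × P` over non-CM curves).
`RealOnePeriodRelations_of` concludes the crux by name modulo the apex alone.

[cite: HuberWustholz2022, Thm 13.3 (2), §13.2, Ch. 15, Thm 6.2] [cite: KontsevichZagier2001, §1.1–§1.2] [cite: WhittakerWatson1927, §20.53]
-/

noncomputable section

open Literature.NumberTheory.Transcendental

namespace Summit.KontsevichZagierPeriods.SymplecticScissors.RealOnePeriodRelations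

/-! ## The apex stub and the composition concluding the crux -/

/-- STUB `stub_huberWustholz` — THE APEX (Huber–Wüstholz 2022 Thm 13.3 (2) for all smooth affine curves over `ℚ̄`, the
Literature named fact `HuberWustholzCurvePeriods`); crux-sized, not proved in this line. [cite: HuberWustholz2022, Thm 13.3 (2)] -/
theorem stub_huberWustholz : Literature.NumberTheory.Transcendental.HuberWustholzCurvePeriods := by
  sorry

/-- **The composition**: the crux `RealOnePeriodRelations` from the stubs of the line — all landed except the apex
(`realOnePeriodRelations_of_huberWustholzCurvePeriods`, p131099). [cite: HuberWustholz2022, Thm 13.3 (2)] -/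
theorem RealOnePeriodRelations_of :
    Summit.KontsevichZagierPeriods.KontsevichZagierPeriods.Theses.SymplecticScissors.RealOnePeriodRelations :=
  realOnePeriodRelations_of_huberWustholzCurvePeriods stub_huberWustholz

/-! ## The theorems of reshapes 10–11 (all landed; referenced here by `example`s so that the skeleton exercises them) -/

example := @TorsionLayer.huberWustholzCurvePeriods_torsionPunctured
example := @TorsionLayer.realOnePeriodRelations_torsionLayer
example := @TorsionLayer.stub_transferTors
example := @TorsionLayer.stub_torsUnit
example := @TorsionLayer.stub_formReductionP
example := @TorsionLayer.stub_torsPolyExists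
example := @TorsionLayer.stub_ellipticLiouville
example := @TorsionLayer.stub_torsArcs
example := @TorsionLayer.huberWustholzCurvePeriods_torsionPunctured_family
example := @TorsionLayer.realOnePeriodRelations_torsionLayer_family
example := @TorsionLayer.stub_torsArcsC
example := @TorsionLayer.stub_torsTailC
example := @TorsionLayer.realOnePeriodRelations_torsionLayerC_family
example := @TorsionLayer.realOnePeriodRelations_unifiedLayer_family

end Summit.KontsevichZagierPeriods.SymplecticScissors.RealOnePeriodRelations

end
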